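import Literature.MathematicalPhysics.QuantumFieldTheory.GaussianToolkit
import Literature.Probability.LatticeModels.GaussianLinearImage
import Literature.Analysis.SpecialFunctions.RealGaussianComplexQuadratic
import HarnessLib

/-!
# Gaussian integrals of exponentials of quadratic forms: the closed forms
# `∫ e^{−½xᵀPx} = (2π)^{n/2}(det P)^{−1/2}` and
# `E_{N(0,S)} e^{½(x+φ)ᵀM(x+φ)} = det(1 − SM)^{−1/2} · e^{½ φᵀ M(1−SM)⁻¹ φ}`

Topic `Probability/Distributions` (next to `GaussianQuadraticExp.lean`, which treats the DAMPED case
`e^{−c x²/2}`, `c ≥ 0`, in one and two dimensions). Here: the AMPLIFIED ("regulator") case in any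
finite dimension, for Mathlib's `ProbabilityTheory.multivariateGaussian 0 S` with a merely positive
SEMIdefinite covariance `S` (singular covariances — e.g. the pieces of a finite-range decomposition —
are allowed):

* `integral_exp_neg_half_quadratic`, `gaussZ_toReal_eq` — the Gaussian normalisation in closed form,
  `∫_{ℝ^ι} e^{−½ xᵀPx} dx = √(2π)^{|ι|} / √(det P)` for positive definite `P` (from the tree's branch-free
  identity `(∫ e^{−½xᵀPx})²·det P = (2π)^{|ι|}`, `RealGaussianComplexQuadratic`);
* `integral_exp_neg_half_quadratic_add_linear` (+ `integrable_…`) — completing the square,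
  `∫ e^{−½ xᵀPx + b·x} dx = √(2π)^{|ι|}/√(det P) · e^{½ bᵀP⁻¹b}`;
* `integral_exp_half_quadratic_shift_multivariateGaussian` (+ `integrable_…`, `det_one_sub_mul_pos_…`,
  the unshifted case `…_multivariateGaussian_zero_shift`, and the positive definite corollary
  `…_of_posDef` under `S⁻¹ − M ≻ 0`) — **the regulator formula**: for `S ⪰ 0`, `M = Mᵀ` with
  `1 − √S M √S ≻ 0`,
  `∫ e^{½ (x+φ)ᵀM(x+φ)} N(0,S)(dx) = e^{½ φᵀ M(1 − SM)⁻¹ φ} / √(det(1 − SM))`, `det(1 − SM) > 0`.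
  Integrating out a Gaussian fluctuation field thus turns the quadratic "regulator" `M` into the
  renormalised regulator `M(1 − SM)⁻¹` at the cost `det(1 − SM)^{−1/2}`; the matrix algebra of iterating
  this along a covariance decomposition (tower factorisation, finite-range additivity) is in
  `Literature/Analysis/Matrix/RegulatorRenormalisation.lean`;
* `norm_integral_shift_le_of_norm_le_exp` (+ `integrable_shift_of_norm_le_exp`, precision form `…_inv`)
  — **regulated sup-norms are stable under Gaussian convolution**: `‖K x‖ ≤ A e^{½xᵀMx}` for all `x`
  implies `‖∫ K(x+φ) N(0,S)(dx)‖ ≤ A e^{½ φᵀM(1−SM)⁻¹φ}/√(det(1 − SM))`.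

All [folklore]; cf. [cite: BauerschmidtBrydgesSlade2019Gaussian, Ch. 2 (Gaussian integrals in finite
dimensions)]. Context: large-field regulators of renormalisation-group analyses (line
`fat-gaussian-defect-calculus` of crux `BalabanIR.BirComplexStableXYR`, Hubbard summit).
-/

noncomputable section

open MeasureTheory ProbabilityTheory Matrix WithLp Real
open scoped ENNReal NNReal MatrixOrder BigOperators
open Literature.MathematicalPhysics.QuantumFieldTheory.GaussianToolkit

namespace Literature.Probability.Distributions

variable {ι : Type*} [Fintype ι] [DecidableEq ι]

/-! ### The Gaussian normalisation in closed form -/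

/-- `det (P.map ofReal) = ofReal (det P)`. [folklore] -/
theorem det_map_ofReal (P : Matrix ι ι ℝ) : (P.map Complex.ofReal).det = (P.det : ℂ) := by
  have h := (RingHom.map_det Complex.ofRealHom P).symm
  rw [RingHom.mapMatrix_apply] at h
  exact h

/-- **The Gaussian integral in closed form**: for a positive definite real matrix `P`,
`∫_{ℝ^ι} e^{−½ xᵀPx} dx = √(2π)^{|ι|} / √(det P)`. [folklore] -/
theorem integral_exp_neg_half_quadratic {P : Matrix ι ι ℝ} (hP : P.PosDef) :
    ∫ x : ι → ℝ, Real.exp (-(x ⬝ᵥ P *ᵥ x) / 2) = Real.sqrt (2 * π) ^ Fintype.card ι / Real.sqrt P.det := by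
  set Z : ℝ := ∫ x : ι → ℝ, Real.exp (-(x ⬝ᵥ P *ᵥ x) / 2) with hZ
  have hsq := Literature.Analysis.SpecialFunctions.sq_integral_cexp_neg_half_mul_det hP
  have hZC : (∫ x : ι → ℝ, Complex.exp (-(1 / 2 : ℂ) * ((x ⬝ᵥ (P *ᵥ x) : ℝ) : ℂ))) = (Z : ℂ) := by
    rw [hZ, ← integral_complex_ofReal]
    refine integral_congr_ae (ae_of_all _ fun x => ?_)
    simp only [Complex.ofReal_exp]
    congr 1
    push_cast
    ring
  rw [hZC, det_map_ofReal] at hsq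
  have hreal : Z ^ 2 * P.det = (2 * π) ^ Fintype.card ι := by
    exact_mod_cast hsq
  have hZpos : 0 < Z := by
    rw [hZ, Literature.Probability.LatticeModels.GaussianCoord.integral_exp_quadratic P]
    exact Literature.Probability.LatticeModels.GaussianCoord.gaussZ_toReal_pos P hP
  have hdet : 0 < P.det := hP.det_pos
  have hZsq : Z ^ 2 = (Real.sqrt (2 * π) ^ Fintype.card ι / Real.sqrt P.det) ^ 2 := by
    rw [div_pow, ← pow_mul, mul_comm (Fintype.card ι) 2, pow_mul, Real.sq_sqrt (by positivity),
      Real.sq_sqrt hdet.le, eq_div_iff hdet.ne']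
    exact hreal
  have hRpos : 0 < Real.sqrt (2 * π) ^ Fintype.card ι / Real.sqrt P.det := by positivity
  nlinarith [sq_nonneg (Z - Real.sqrt (2 * π) ^ Fintype.card ι / Real.sqrt P.det),
    sq_nonneg (Z + Real.sqrt (2 * π) ^ Fintype.card ι / Real.sqrt P.det)]

/-- **Closed form of the normalisation `Z_P = gaussZ P`** of `GaussianToolkit`:
`Z_P = √(2π)^{|ι|} / √(det P)` for positive definite `P`. [folklore] -/
theorem gaussZ_toReal_eq {P : Matrix ι ι ℝ} (hP : P.PosDef) :
    (gaussZ P).toReal = Real.sqrt (2 * π) ^ Fintype.card ι / Real.sqrt P.det := by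
  rw [← Literature.Probability.LatticeModels.GaussianCoord.integral_exp_quadratic P]
  exact integral_exp_neg_half_quadratic hP

/-! ### Completing the square -/

omit [Fintype ι] [DecidableEq ι] in
/-- `Pᵀ = P` for a real positive definite matrix. [folklore] -/
theorem transpose_eq_of_posDef {P : Matrix ι ι ℝ} (hP : P.PosDef) : Pᵀ = P := by
  have h := hP.isHermitian
  rwa [Matrix.IsHermitian, Matrix.conjTranspose_eq_transpose_of_trivial] at h

/-- **Completing the square**: `−½ xᵀPx + b·x = −½ (x − h)ᵀP(x − h) + ½ bᵀP⁻¹b`, `h = P⁻¹b`.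
[folklore] -/
theorem neg_half_quadratic_add_linear_eq {P : Matrix ι ι ℝ} (hP : P.PosDef) (b x : ι → ℝ) :
    -(x ⬝ᵥ P *ᵥ x) / 2 + b ⬝ᵥ x =
      -((x - P⁻¹ *ᵥ b) ⬝ᵥ P *ᵥ (x - P⁻¹ *ᵥ b)) / 2 + (b ⬝ᵥ P⁻¹ *ᵥ b) / 2 := by
  set h : ι → ℝ := P⁻¹ *ᵥ b with hh
  have hPT : Pᵀ = P := transpose_eq_of_posDef hP
  have hPu : IsUnit P.det := (Matrix.isUnit_iff_isUnit_det _).1 hP.isUnit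
  have hPh : P *ᵥ h = b := by
    rw [hh, Matrix.mulVec_mulVec, Matrix.mul_nonsing_inv _ hPu, Matrix.one_mulVec]
  have h1 : h ⬝ᵥ P *ᵥ x = b ⬝ᵥ x := by
    rw [Matrix.dotProduct_mulVec, ← Matrix.mulVec_transpose, hPT, hPh]
  have h2 : x ⬝ᵥ P *ᵥ h = b ⬝ᵥ x := by
    rw [hPh, dotProduct_comm]
  have h3 : h ⬝ᵥ P *ᵥ h = b ⬝ᵥ h := by
    rw [hPh, dotProduct_comm]
  have e1 : (x - h) ⬝ᵥ P *ᵥ (x - h) = x ⬝ᵥ P *ᵥ x - 2 * (b ⬝ᵥ x) + b ⬝ᵥ h := by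
    rw [Matrix.mulVec_sub, dotProduct_sub, sub_dotProduct, sub_dotProduct, h1, h2, h3]
    ring
  rw [e1]
  ring

/-- **Gaussian integral with a linear term**: for positive definite `P` and `b ∈ ℝ^ι`,
`∫_{ℝ^ι} e^{−½ xᵀPx + b·x} dx = √(2π)^{|ι|}/√(det P) · e^{½ bᵀP⁻¹b}`. [folklore] -/
theorem integral_exp_neg_half_quadratic_add_linear {P : Matrix ι ι ℝ} (hP : P.PosDef) (b : ι → ℝ) :
    ∫ x : ι → ℝ, Real.exp (-(x ⬝ᵥ P *ᵥ x) / 2 + b ⬝ᵥ x) =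
      Real.sqrt (2 * π) ^ Fintype.card ι / Real.sqrt P.det * Real.exp ((b ⬝ᵥ P⁻¹ *ᵥ b) / 2) := by
  simp_rw [neg_half_quadratic_add_linear_eq hP b, Real.exp_add]
  rw [integral_mul_const]
  congr 1
  rw [← integral_exp_neg_half_quadratic hP]
  exact integral_sub_right_eq_self (μ := (volume : Measure (ι → ℝ)))
    (fun x => Real.exp (-(x ⬝ᵥ P *ᵥ x) / 2)) (P⁻¹ *ᵥ b)

/-- The integrand `e^{−½ xᵀPx + b·x}` is integrable on `ℝ^ι` for positive definite `P`. [folklore] -/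
theorem integrable_exp_neg_half_quadratic_add_linear {P : Matrix ι ι ℝ} (hP : P.PosDef) (b : ι → ℝ) :
    Integrable fun x : ι → ℝ => Real.exp (-(x ⬝ᵥ P *ᵥ x) / 2 + b ⬝ᵥ x) := by
  simp_rw [neg_half_quadratic_add_linear_eq hP b, Real.exp_add]
  refine Integrable.mul_const ?_ _
  exact (Literature.Probability.LatticeModels.GaussianCoord.integrable_exp_quadratic P hP).comp_sub_right
    (P⁻¹ *ᵥ b)

/-! ### The regulator formula for `N(0, S)` -/

section Regulator

variable {S M : Matrix ι ι ℝ}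

omit [DecidableEq ι] in
/-- Pointwise: for symmetric `T, M`,
`−½ z·z + ½ (Tz+φ)ᵀM(Tz+φ) = −½ zᵀ(1 − TMT)z + (TMφ)·z + ½ φᵀMφ`. [folklore] -/
theorem neg_half_add_half_quadratic_shift_eq [DecidableEq ι] {T M : Matrix ι ι ℝ} (hT : Tᵀ = T) (hM : Mᵀ = M)
    (φ z : ι → ℝ) :
    -(z ⬝ᵥ z) / 2 + ((T *ᵥ z + φ) ⬝ᵥ M *ᵥ (T *ᵥ z + φ)) / 2 =
      -(z ⬝ᵥ (1 - T * M * T) *ᵥ z) / 2 + ((T * M) *ᵥ φ) ⬝ᵥ z + (φ ⬝ᵥ M *ᵥ φ) / 2 := by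
  have h1 : (T *ᵥ z) ⬝ᵥ M *ᵥ (T *ᵥ z) = z ⬝ᵥ (T * M * T) *ᵥ z := by
    rw [Literature.Analysis.SpecialFunctions.dotProduct_mulVec_mulVec_eq, hT]
  have h2 : (T *ᵥ z) ⬝ᵥ M *ᵥ φ = ((T * M) *ᵥ φ) ⬝ᵥ z := by
    rw [dotProduct_comm, Matrix.dotProduct_mulVec, ← Matrix.mulVec_transpose, hT, Matrix.mulVec_mulVec]
  have h3 : φ ⬝ᵥ M *ᵥ (T *ᵥ z) = ((T * M) *ᵥ φ) ⬝ᵥ z := by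
    rw [Matrix.dotProduct_mulVec, ← Matrix.mulVec_transpose, hM, ← h2, dotProduct_comm]
  have h4 : z ⬝ᵥ (1 - T * M * T) *ᵥ z = z ⬝ᵥ z - z ⬝ᵥ (T * M * T) *ᵥ z := by
    rw [Matrix.sub_mulVec, Matrix.one_mulVec, dotProduct_sub]
  rw [Matrix.mulVec_add, dotProduct_add, add_dotProduct, add_dotProduct, h1, h2, h3, h4]
  ring

/-- `det(1 − √S M √S) = det(1 − SM)` (for `√S √S = S`). [folklore] -/
theorem det_one_sub_sqrt_mul_sqrt {T : Matrix ι ι ℝ} (hTT : T * T = S) (M : Matrix ι ι ℝ) :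
    (1 - T * M * T).det = (1 - S * M).det := by
  rw [Matrix.mul_assoc, Matrix.det_one_sub_mul_comm, Matrix.mul_assoc, hTT, Matrix.det_one_sub_mul_comm]

/-- The push-through identity behind the renormalised regulator:
`M + M√S(1 − √S M √S)⁻¹√S M = M(1 − SM)⁻¹`. [folklore] -/
theorem add_mul_inv_mul_eq_mul_inv_one_sub {T : Matrix ι ι ℝ} (hTT : T * T = S)
    (hU : IsUnit (1 - T * M * T).det) :
    M + M * T * (1 - T * M * T)⁻¹ * T * M = M * (1 - S * M)⁻¹ := by
  have hU' : IsUnit (1 - S * M).det := by rwa [← det_one_sub_sqrt_mul_sqrt hTT]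
  have key : (M + M * T * (1 - T * M * T)⁻¹ * T * M) * (1 - S * M) = M := by
    have hTM : T * M * (1 - S * M) = (1 - T * M * T) * (T * M) := by
      rw [Matrix.mul_sub, Matrix.sub_mul, Matrix.mul_one, Matrix.one_mul, ← hTT]
      simp only [Matrix.mul_assoc]
    rw [Matrix.add_mul, Matrix.mul_assoc (M * T * (1 - T * M * T)⁻¹), Matrix.mul_assoc (M * T * (1 - T * M * T)⁻¹),
      hTM, ← Matrix.mul_assoc (M * T * (1 - T * M * T)⁻¹), Matrix.nonsing_inv_mul_cancel_right _ _ hU,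
      Matrix.mul_sub, Matrix.mul_one, ← hTT]
    simp only [Matrix.mul_assoc]
    abel
  calc M + M * T * (1 - T * M * T)⁻¹ * T * M
      = (M + M * T * (1 - T * M * T)⁻¹ * T * M) * (1 - S * M) * (1 - S * M)⁻¹ := by
        rw [Matrix.mul_nonsing_inv_cancel_right _ _ hU']
    _ = M * (1 - S * M)⁻¹ := by rw [key]

omit [DecidableEq ι] in
/-- Continuity of the tilted integrand on Euclidean space. [folklore] -/
theorem continuous_exp_half_quadratic_shift (M : Matrix ι ι ℝ) (φ : ι → ℝ) :
    Continuous fun x : EuclideanSpace ℝ ι => Real.exp (((ofLp x + φ) ⬝ᵥ M *ᵥ (ofLp x + φ)) / 2) := by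
  have h1 : Continuous fun x : EuclideanSpace ℝ ι => (ofLp x : ι → ℝ) + φ :=
    (PiLp.continuous_ofLp 2 _).add continuous_const
  exact Real.continuous_exp.comp ((h1.dotProduct (continuous_const.matrix_mulVec h1)).div_const _)

/-- Pointwise form of the standard Gaussian density times the tilted exponential at `√S y`. [folklore] -/
theorem stdGaussianDensity_toReal_smul_exp_eq (S M : Matrix ι ι ℝ) (φ : ι → ℝ) (y : EuclideanSpace ℝ ι) :
    (stdGaussianDensity ι y).toReal •
        Real.exp (((ofLp (toEuclideanCLM (n := ι) (𝕜 := ℝ) (CFC.sqrt S) y) + φ) ⬝ᵥ M *ᵥ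
          (ofLp (toEuclideanCLM (n := ι) (𝕜 := ℝ) (CFC.sqrt S) y) + φ)) / 2) =
      (Real.sqrt (2 * π))⁻¹ ^ Fintype.card ι *
        Real.exp (-(ofLp y ⬝ᵥ ofLp y) / 2 +
          ((CFC.sqrt S *ᵥ ofLp y + φ) ⬝ᵥ M *ᵥ (CFC.sqrt S *ᵥ ofLp y + φ)) / 2) := by
  simp only [stdGaussianDensity, smul_eq_mul]
  rw [ENNReal.toReal_ofReal (by positivity), ofLp_toEuclideanCLM, mul_assoc, ← Real.exp_add]
  congr 2
  rw [← real_inner_self_eq_norm_sq, EuclideanSpace.inner_eq_star_dotProduct, star_trivial]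

/-- Reduction of the `N(0,S)`-integral of the tilted exponential to a Lebesgue integral on `ℝ^ι`:
with `T = √S`, `∫ F dN(0,S) = √(2π)^{−|ι|} ∫ e^{−½ z·z} F(Tz) dz`. [folklore] -/
theorem integral_multivariateGaussian_eq_integral_sqrt (S M : Matrix ι ι ℝ) (φ : ι → ℝ) :
    ∫ x, Real.exp (((ofLp x + φ) ⬝ᵥ M *ᵥ (ofLp x + φ)) / 2) ∂(multivariateGaussian 0 S) =
      ∫ z : ι → ℝ, (Real.sqrt (2 * π))⁻¹ ^ Fintype.card ι *
        Real.exp (-(z ⬝ᵥ z) / 2 + ((CFC.sqrt S *ᵥ z + φ) ⬝ᵥ M *ᵥ (CFC.sqrt S *ᵥ z + φ)) / 2) := by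
  set F : EuclideanSpace ℝ ι → ℝ := fun x => Real.exp (((ofLp x + φ) ⬝ᵥ M *ᵥ (ofLp x + φ)) / 2) with hF
  have hFc : Continuous F := continuous_exp_half_quadratic_shift M φ
  have h1 : ∫ x, F x ∂(multivariateGaussian 0 S) =
      ∫ y, F (toEuclideanCLM (n := ι) (𝕜 := ℝ) (CFC.sqrt S) y) ∂(stdGaussian (EuclideanSpace ℝ ι)) := by
    rw [multivariateGaussian, integral_map (by fun_prop) hFc.aestronglyMeasurable]
    simp only [zero_add]
  rw [h1, stdGaussian_eq_withDensity,
    integral_withDensity_eq_integral_toReal_smul (measurable_stdGaussianDensity (ι := ι))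
      (ae_of_all _ fun _ => ENNReal.ofReal_lt_top),
    ← (EuclideanSpace.volume_preserving_symm_measurableEquiv_toLp ι).integral_comp']
  refine integral_congr_ae (ae_of_all _ fun z => ?_)
  simp only [MeasurableEquiv.coe_toLp_symm, hF]
  exact stdGaussianDensity_toReal_smul_exp_eq S M φ z

/-- **Positivity of the determinant**: under `1 − √S M √S ≻ 0`, `det(1 − SM) > 0`. [folklore] -/
theorem det_one_sub_mul_pos_of_posDef (hS : S.PosSemidef) (hsub : (1 - CFC.sqrt S * M * CFC.sqrt S).PosDef) :
    0 < (1 - S * M).det := by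
  rw [← det_one_sub_sqrt_mul_sqrt (CFC.sqrt_mul_sqrt_self S hS.nonneg) M]
  exact hsub.det_pos

/-- **The regulator formula.** For a positive semidefinite covariance `S`, a symmetric `M` with
`1 − √S M √S` positive definite, and any shift `φ`,
`∫ e^{½ (x+φ)ᵀM(x+φ)} N(0,S)(dx) = e^{½ φᵀ M(1−SM)⁻¹ φ} / √(det(1 − SM))`. [folklore] -/
theorem integral_exp_half_quadratic_shift_multivariateGaussian (hS : S.PosSemidef) (hM : Mᵀ = M)
    (hsub : (1 - CFC.sqrt S * M * CFC.sqrt S).PosDef) (φ : ι → ℝ) :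
    ∫ x, Real.exp (((ofLp x + φ) ⬝ᵥ M *ᵥ (ofLp x + φ)) / 2) ∂(multivariateGaussian 0 S) =
      Real.exp ((φ ⬝ᵥ (M * (1 - S * M)⁻¹) *ᵥ φ) / 2) / Real.sqrt (1 - S * M).det := by
  rw [integral_multivariateGaussian_eq_integral_sqrt S M φ]
  set T := CFC.sqrt S with hTdef
  have hT : Tᵀ = T := transpose_sqrt (S := S)
  have hTT : T * T = S := CFC.sqrt_mul_sqrt_self S hS.nonneg
  have hU : IsUnit (1 - T * M * T).det := hsub.isUnit.map (Matrix.detMonoidHom)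
  simp_rw [neg_half_add_half_quadratic_shift_eq hT hM φ, Real.exp_add]
  have hI := integral_exp_neg_half_quadratic_add_linear hsub ((T * M) *ᵥ φ)
  simp_rw [Real.exp_add] at hI
  rw [integral_const_mul, integral_mul_const, hI, det_one_sub_sqrt_mul_sqrt hTT M]
  -- the exponent
  have hexp : ((T * M) *ᵥ φ) ⬝ᵥ (1 - T * M * T)⁻¹ *ᵥ ((T * M) *ᵥ φ) + φ ⬝ᵥ M *ᵥ φ =
      φ ⬝ᵥ (M * (1 - S * M)⁻¹) *ᵥ φ := by
    rw [Literature.Analysis.SpecialFunctions.dotProduct_mulVec_mulVec_eq, Matrix.transpose_mul, hT, hM,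
      ← add_mul_inv_mul_eq_mul_inv_one_sub hTT hU, Matrix.add_mulVec, dotProduct_add, add_comm,
      Matrix.mul_assoc (M * T * (1 - T * M * T)⁻¹) T M]
  have hcard : (Real.sqrt (2 * π))⁻¹ ^ Fintype.card ι * (Real.sqrt (2 * π) ^ Fintype.card ι) = 1 := by
    rw [inv_pow, inv_mul_cancel₀ (by positivity)]
  rw [← hexp, add_div, Real.exp_add]
  calc (Real.sqrt (2 * π))⁻¹ ^ Fintype.card ι *
        (Real.sqrt (2 * π) ^ Fintype.card ι / Real.sqrt (1 - S * M).det *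
            Real.exp (((T * M) *ᵥ φ) ⬝ᵥ (1 - T * M * T)⁻¹ *ᵥ ((T * M) *ᵥ φ) / 2) *
          Real.exp (φ ⬝ᵥ M *ᵥ φ / 2))
      = ((Real.sqrt (2 * π))⁻¹ ^ Fintype.card ι * Real.sqrt (2 * π) ^ Fintype.card ι) *
          (Real.exp (((T * M) *ᵥ φ) ⬝ᵥ (1 - T * M * T)⁻¹ *ᵥ ((T * M) *ᵥ φ) / 2) *
            Real.exp (φ ⬝ᵥ M *ᵥ φ / 2)) / Real.sqrt (1 - S * M).det := by ring
    _ = _ := by rw [hcard, one_mul]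

/-- **Integrability** of the tilted exponential under `N(0,S)` (for any `S`: when `S` is not positive
semidefinite Mathlib's `CFC.sqrt S` is `0` and `multivariateGaussian 0 S` a Dirac mass). [folklore] -/
theorem integrable_exp_half_quadratic_shift_multivariateGaussian (hM : Mᵀ = M)
    (hsub : (1 - CFC.sqrt S * M * CFC.sqrt S).PosDef) (φ : ι → ℝ) :
    Integrable (fun x : EuclideanSpace ℝ ι => Real.exp (((ofLp x + φ) ⬝ᵥ M *ᵥ (ofLp x + φ)) / 2))
      (multivariateGaussian 0 S) := by
  have hFc := continuous_exp_half_quadratic_shift M φ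
  have hT : (CFC.sqrt S)ᵀ = CFC.sqrt S := transpose_sqrt (S := S)
  rw [multivariateGaussian]
  refine (integrable_map_measure hFc.aestronglyMeasurable (by fun_prop)).2 ?_
  rw [stdGaussian_eq_withDensity,
    integrable_withDensity_iff_integrable_smul' (measurable_stdGaussianDensity (ι := ι))
      (ae_of_all _ fun _ => ENNReal.ofReal_lt_top)]
  set g : (ι → ℝ) → ℝ := fun z => (Real.sqrt (2 * π))⁻¹ ^ Fintype.card ι *
    Real.exp (-(z ⬝ᵥ z) / 2 + ((CFC.sqrt S *ᵥ z + φ) ⬝ᵥ M *ᵥ (CFC.sqrt S *ᵥ z + φ)) / 2) with hg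
  have hfun : ∀ y : EuclideanSpace ℝ ι, (stdGaussianDensity ι y).toReal •
      ((fun x : EuclideanSpace ℝ ι => Real.exp (((ofLp x + φ) ⬝ᵥ M *ᵥ (ofLp x + φ)) / 2)) ∘
        (fun x : EuclideanSpace ℝ ι => (0 : EuclideanSpace ℝ ι) + toEuclideanCLM (n := ι) (𝕜 := ℝ) (CFC.sqrt S) x)) y
      = (g ∘ (MeasurableEquiv.toLp 2 (ι → ℝ)).symm) y := by
    intro y
    simp only [Function.comp_apply, MeasurableEquiv.coe_toLp_symm, zero_add, hg]
    exact stdGaussianDensity_toReal_smul_exp_eq S M φ y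
  rw [integrable_congr (ae_of_all _ hfun),
    (EuclideanSpace.volume_preserving_symm_measurableEquiv_toLp ι).integrable_comp_emb
      (MeasurableEquiv.measurableEmbedding _)]
  have hg' : g = fun z => (Real.sqrt (2 * π))⁻¹ ^ Fintype.card ι *
      (Real.exp (-(z ⬝ᵥ (1 - CFC.sqrt S * M * CFC.sqrt S) *ᵥ z) / 2 + ((CFC.sqrt S * M) *ᵥ φ) ⬝ᵥ z) *
        Real.exp ((φ ⬝ᵥ M *ᵥ φ) / 2)) := by
    funext z
    simp only [hg]
    rw [neg_half_add_half_quadratic_shift_eq hT hM φ z, Real.exp_add]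
  rw [hg']
  exact ((integrable_exp_neg_half_quadratic_add_linear hsub _).mul_const _).const_mul _

/-- **The regulator formula, unshifted**: `∫ e^{½ xᵀMx} N(0,S)(dx) = 1/√(det(1 − SM))`. [folklore] -/
theorem integral_exp_half_quadratic_multivariateGaussian (hS : S.PosSemidef) (hM : Mᵀ = M)
    (hsub : (1 - CFC.sqrt S * M * CFC.sqrt S).PosDef) :
    ∫ x, Real.exp ((ofLp x ⬝ᵥ M *ᵥ ofLp x) / 2) ∂(multivariateGaussian 0 S) =
      1 / Real.sqrt (1 - S * M).det := by
  have h := integral_exp_half_quadratic_shift_multivariateGaussian hS hM hsub 0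
  simpa using h

/-- For positive definite `S`, the hypothesis `S⁻¹ − M ≻ 0` gives `1 − √S M √S ≻ 0`. [folklore] -/
theorem posDef_one_sub_sqrt_mul_sqrt (hS : S.PosDef) (hSM : (S⁻¹ - M).PosDef) :
    (1 - CFC.sqrt S * M * CFC.sqrt S).PosDef := by
  set T := CFC.sqrt S with hTdef
  have hT : Tᵀ = T := transpose_sqrt (S := S)
  have hTu : IsUnit T := isUnit_sqrt hS
  have hTdu : IsUnit T.det := (Matrix.isUnit_iff_isUnit_det T).1 hTu
  have key : 1 - T * M * T = Tᴴ * (S⁻¹ - M) * T := by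
    rw [Matrix.conjTranspose_eq_transpose_of_trivial, hT, Matrix.mul_sub, Matrix.sub_mul,
      ← sqrt_inv_mul_sqrt_inv hS, ← hTdef, ← Matrix.mul_assoc T, Matrix.mul_nonsing_inv T hTdu,
      Matrix.one_mul, Matrix.nonsing_inv_mul T hTdu]
  rw [key]
  exact hSM.conjTranspose_mul_mul_same (Matrix.mulVec_injective_of_isUnit hTu)

/-- **The regulator formula for a non-degenerate Gaussian**: for positive definite `S`, symmetric `M`
with `S⁻¹ − M ≻ 0`, `∫ e^{½ (x+φ)ᵀM(x+φ)} N(0,S)(dx) = e^{½ φᵀM(1−SM)⁻¹φ}/√(det(1 − SM))`, and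
`det(1 − SM) > 0`. [folklore] -/
theorem integral_exp_half_quadratic_shift_multivariateGaussian_of_posDef (hS : S.PosDef) (hM : Mᵀ = M)
    (hSM : (S⁻¹ - M).PosDef) (φ : ι → ℝ) :
    ∫ x, Real.exp (((ofLp x + φ) ⬝ᵥ M *ᵥ (ofLp x + φ)) / 2) ∂(multivariateGaussian 0 S) =
        Real.exp ((φ ⬝ᵥ (M * (1 - S * M)⁻¹) *ᵥ φ) / 2) / Real.sqrt (1 - S * M).det ∧
      0 < (1 - S * M).det :=
  ⟨integral_exp_half_quadratic_shift_multivariateGaussian hS.posSemidef hM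
      (posDef_one_sub_sqrt_mul_sqrt hS hSM) φ,
    det_one_sub_mul_pos_of_posDef hS.posSemidef (posDef_one_sub_sqrt_mul_sqrt hS hSM)⟩

/-- **Precision-matrix form**: for `X ∼ N(0, P⁻¹)` with `P ≻ 0` and symmetric `M` with `P − M ≻ 0`,
`E e^{½ (X+φ)ᵀM(X+φ)} = e^{½ φᵀM(1−P⁻¹M)⁻¹φ}/√(det(1 − P⁻¹M))`, `det(1 − P⁻¹M) = det(P − M)/det P > 0`.
[folklore] -/
theorem integral_exp_half_quadratic_shift_multivariateGaussian_inv {P : Matrix ι ι ℝ} (hP : P.PosDef)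
    (hM : Mᵀ = M) (hPM : (P - M).PosDef) (φ : ι → ℝ) :
    ∫ x, Real.exp (((ofLp x + φ) ⬝ᵥ M *ᵥ (ofLp x + φ)) / 2) ∂(multivariateGaussian 0 P⁻¹) =
        Real.exp ((φ ⬝ᵥ (M * (1 - P⁻¹ * M)⁻¹) *ᵥ φ) / 2) / Real.sqrt (1 - P⁻¹ * M).det ∧
      0 < (1 - P⁻¹ * M).det ∧ (1 - P⁻¹ * M).det = (P - M).det / P.det := by
  have hPinv : P⁻¹⁻¹ = P :=
    Matrix.nonsing_inv_nonsing_inv P ((Matrix.isUnit_iff_isUnit_det _).1 hP.isUnit)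
  have hSM : (P⁻¹⁻¹ - M).PosDef := by rwa [hPinv]
  obtain ⟨h1, h2⟩ := integral_exp_half_quadratic_shift_multivariateGaussian_of_posDef hP.inv hM hSM φ
  refine ⟨h1, h2, ?_⟩
  have hPu : IsUnit P.det := (Matrix.isUnit_iff_isUnit_det _).1 hP.isUnit
  have hfac : 1 - P⁻¹ * M = P⁻¹ * (P - M) := by
    rw [Matrix.mul_sub, Matrix.nonsing_inv_mul _ hPu]
  rw [hfac, Matrix.det_mul, Matrix.det_nonsing_inv, Ring.inverse_eq_inv, div_eq_inv_mul]

end Regulator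


/-! ### Regulated sup-norms under Gaussian convolution -/

section RegulatedNorm

variable {S M : Matrix ι ι ℝ}

/-- **Regulated sup-norms are stable under Gaussian convolution, with the renormalised regulator.**
If `‖K x‖ ≤ A·e^{½ xᵀMx}` for all `x` (regulated sup-norm `≤ A` for the regulator `M`), then for `S ⪰ 0`,
`M = Mᵀ` with `1 − √S M √S ≻ 0` and every `φ`,
`‖∫ K(x + φ) N(0,S)(dx)‖ ≤ A · e^{½ φᵀ M(1−SM)⁻¹ φ} / √(det(1 − SM))`
— i.e. the Gaussian convolution has regulated sup-norm `≤ A·det(1 − SM)^{−1/2}` for the renormalised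
regulator `M′ = M(1 − SM)⁻¹`. No measurability of `K` is needed. [folklore] -/
theorem norm_integral_shift_le_of_norm_le_exp {E : Type*} [NormedAddCommGroup E] [NormedSpace ℝ E]
    (hS : S.PosSemidef) (hM : Mᵀ = M) (hsub : (1 - CFC.sqrt S * M * CFC.sqrt S).PosDef)
    {K : (ι → ℝ) → E} {A : ℝ} (hK : ∀ x, ‖K x‖ ≤ A * Real.exp ((x ⬝ᵥ M *ᵥ x) / 2)) (φ : ι → ℝ) :
    ‖∫ x, K (ofLp x + φ) ∂(multivariateGaussian 0 S)‖ ≤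
      A * (Real.exp ((φ ⬝ᵥ (M * (1 - S * M)⁻¹) *ᵥ φ) / 2) / Real.sqrt (1 - S * M).det) := by
  have hint := integrable_exp_half_quadratic_shift_multivariateGaussian hM hsub φ
  have hval := integral_exp_half_quadratic_shift_multivariateGaussian hS hM hsub φ
  calc ‖∫ x, K (ofLp x + φ) ∂(multivariateGaussian 0 S)‖
      ≤ ∫ x, ‖K (ofLp x + φ)‖ ∂(multivariateGaussian 0 S) := norm_integral_le_integral_norm _
    _ ≤ ∫ x, A * Real.exp (((ofLp x + φ) ⬝ᵥ M *ᵥ (ofLp x + φ)) / 2) ∂(multivariateGaussian 0 S) := by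
        refine integral_mono_of_nonneg (ae_of_all _ fun _ => norm_nonneg _) (hint.const_mul A)
          (ae_of_all _ fun _ => hK _)
    _ = A * (Real.exp ((φ ⬝ᵥ (M * (1 - S * M)⁻¹) *ᵥ φ) / 2) / Real.sqrt (1 - S * M).det) := by
        rw [integral_const_mul, hval]

/-- Under the same domination, a (strongly) measurable `K(· + φ)` is integrable against `N(0,S)`.
[folklore] -/
theorem integrable_shift_of_norm_le_exp {E : Type*} [NormedAddCommGroup E] [NormedSpace ℝ E]
    (hM : Mᵀ = M) (hsub : (1 - CFC.sqrt S * M * CFC.sqrt S).PosDef)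
    {K : (ι → ℝ) → E} {A : ℝ} (hK : ∀ x, ‖K x‖ ≤ A * Real.exp ((x ⬝ᵥ M *ᵥ x) / 2)) (φ : ι → ℝ)
    (hKm : AEStronglyMeasurable (fun x : EuclideanSpace ℝ ι => K (ofLp x + φ)) (multivariateGaussian 0 S)) :
    Integrable (fun x : EuclideanSpace ℝ ι => K (ofLp x + φ)) (multivariateGaussian 0 S) :=
  ((integrable_exp_half_quadratic_shift_multivariateGaussian hM hsub φ).const_mul A).mono' hKm
    (ae_of_all _ fun _ => hK _)

/-- **Precision-matrix form of the regulated-norm bound**: for `X ∼ N(0,P⁻¹)`, `P ≻ 0`, `P − M ≻ 0`,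
`‖E K(X + φ)‖ ≤ A·e^{½ φᵀM(1−P⁻¹M)⁻¹φ}/√(det(1 − P⁻¹M))`. [folklore] -/
theorem norm_integral_shift_le_of_norm_le_exp_inv {E : Type*} [NormedAddCommGroup E] [NormedSpace ℝ E]
    {P : Matrix ι ι ℝ} (hP : P.PosDef) (hM : Mᵀ = M) (hPM : (P - M).PosDef)
    {K : (ι → ℝ) → E} {A : ℝ} (hK : ∀ x, ‖K x‖ ≤ A * Real.exp ((x ⬝ᵥ M *ᵥ x) / 2)) (φ : ι → ℝ) :
    ‖∫ x, K (ofLp x + φ) ∂(multivariateGaussian 0 P⁻¹)‖ ≤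
      A * (Real.exp ((φ ⬝ᵥ (M * (1 - P⁻¹ * M)⁻¹) *ᵥ φ) / 2) / Real.sqrt (1 - P⁻¹ * M).det) := by
  have hPinv : P⁻¹⁻¹ = P :=
    Matrix.nonsing_inv_nonsing_inv P ((Matrix.isUnit_iff_isUnit_det _).1 hP.isUnit)
  have hSM : (P⁻¹⁻¹ - M).PosDef := by rwa [hPinv]
  exact norm_integral_shift_le_of_norm_le_exp hP.inv.posSemidef hM (posDef_one_sub_sqrt_mul_sqrt hP.inv hSM) hK φ

end RegulatedNorm

end Literature.Probability.Distributions
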